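import Mathlib.LinearAlgebra.UnitaryGroup
import Mathlib.Topology.Algebra.Algebra
import Literature.AlgebraicTopology.FundamentalGroup.RotationGroupSO3
import HarnessLib

/-!
# Stub `stub_so3_latticeRep` (I2): the defining unitary representation of `SO(3)`

Crux `stmt-QuantumFields-16405`
(`Summit.QuantumFields.YangMills.Theses.ConvexGribovBody.NonSimplyConnectedLatticeGap`),
line `Sketch`, stub `stub_so3_latticeRep`.

The defining representation of `SO(3) = {M ∈ M₃(ℝ) | Mᵀ M = 1, det M = 1}` read with complex
entries, `ρ g = g.1.map (algebraMap ℝ ℂ) : SO(3) →* M₃(ℂ)`, is a continuous injective monoid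
homomorphism with values in the unitary group `U(3)` (a real orthogonal matrix is unitary). This is
the faithful unitary lattice representation of the first admissible instance `G = SO(3)` of the
crux's hypothesis class (it yields `Nonempty (LatticeRep SO3)`, the "Lie" half of
`IsCompactSimpleLieGroup SO3`).
-/

set_option autoImplicit false

namespace Summit.QuantumFields.YangMills.Theorems.NonSimplyConnectedLatticeGap

open scoped Matrix
open Literature.AlgebraicTopology.FundamentalGroup

/-- **The defining representation of `SO(3)` is a faithful continuous unitary representation.**
There is a monoid homomorphism `ρ : SO(3) →* M₃(ℂ)` with `ρ g = g.1.map (algebraMap ℝ ℂ)` (the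
real rotation matrix read with complex entries); it is continuous, injective, and unitary-valued
(`ρ g (ρ g)* = (g gᵀ) ⊗ ℂ = 1`). [folklore] -/
theorem stub_so3_latticeRep :
    ∃ ρ : Literature.AlgebraicTopology.FundamentalGroup.SO3 →* Matrix (Fin 3) (Fin 3) ℂ,
      (∀ g, ρ g = g.1.map (algebraMap ℝ ℂ)) ∧ Continuous ρ ∧ Function.Injective ρ ∧
      ∀ g, ρ g ∈ Matrix.unitaryGroup (Fin 3) ℂ := by
  -- `star ∘ algebraMap ℝ ℂ = algebraMap ℝ ℂ`: complex conjugation fixes the reals.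
  have hconj : ∀ x : ℝ, star (algebraMap ℝ ℂ x) = algebraMap ℝ ℂ x := fun x =>
    Complex.conj_ofReal x
  -- the complexified transpose is the conjugate transpose of the complexification
  have hstar : ∀ g : SO3, star (g.1.map (algebraMap ℝ ℂ)) = g.1ᵀ.map (algebraMap ℝ ℂ) := by
    intro g
    rw [Matrix.star_eq_conjTranspose]
    ext i j
    simp only [Matrix.conjTranspose_apply, Matrix.map_apply, Matrix.transpose_apply, hconj]
  refine ⟨{ toFun := fun g => g.1.map (algebraMap ℝ ℂ),
            map_one' := ?_,
            map_mul' := ?_ }, ?_, ?_, ?_, ?_⟩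
  · -- `ρ 1 = 1`
    show (1 : SO3).1.map (algebraMap ℝ ℂ) = 1
    rw [SO3.coe_one, Matrix.map_one _ (map_zero _) (map_one _)]
  · -- `ρ (a b) = ρ a ρ b`
    intro a b
    show (a * b).1.map (algebraMap ℝ ℂ) = a.1.map (algebraMap ℝ ℂ) * b.1.map (algebraMap ℝ ℂ)
    rw [SO3.coe_mul, Matrix.map_mul]
  · -- the defining formula
    intro g
    rfl
  · -- continuity: entrywise `Complex.ofReal ∘ Subtype.val`
    exact continuous_subtype_val.matrix_map (continuous_algebraMap ℝ ℂ)
  · -- injectivity: `algebraMap ℝ ℂ` and `Subtype.val` are injective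
    intro a b h
    exact Subtype.ext (Matrix.map_injective (algebraMap ℝ ℂ).injective h)
  · -- unitarity: `ρ g ⋆(ρ g) = (g.1 g.1ᵀ).map _ = 1`
    intro g
    rw [Matrix.mem_unitaryGroup_iff]
    show g.1.map (algebraMap ℝ ℂ) * star (g.1.map (algebraMap ℝ ℂ)) = 1
    rw [hstar, ← Matrix.map_mul, SO3.mul_transpose_self, Matrix.map_one _ (map_zero _) (map_one _)]

end Summit.QuantumFields.YangMills.Theorems.NonSimplyConnectedLatticeGap
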